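import Summits.QuantumFields.YangMills.Theorems.BalabanUVNodesN19RateEdgeHolderD4AtN16PinnedReading
import Summits.QuantumFields.YangMills.Theorems.BalabanUVNodesSpineReadingOfRecord13CoPHV

/-!
# BalabanUVNodes ∕ N19 — K3⁷ v5's N19′ SLOT AT THE V READING `crOfRecord₁₃VAt K₀ (jc …) sh` WITH NODE N16's LAYER PINNED LOOSE: the N16-pinned link reading of the sibling
# `…D4AtN16PinnedReading` at v3∕v5's witness reading (per-tuple cut `jc`, shell split `sh`; `PinnedAtLive jc sh cr` names `crOfRecord₁₃V (jc …) sh = crOfRecord₁₃VAt 0 (jc …) sh`),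
# (ii-m) ON THE FAMILY's LATTICES, the volume sign definitional — v9 − 32 conjuncts; and N19′'s edge on tuned bare sequences there

Cell `pub-ymgap`, HUMAN RULING D-0062 (Track A), WIDTH SEAT `pub-ymgap-dag-n19-w3` (N19 NE7, seat 3 of 3), generation g3; bus INTENT-3.  Cluster item K3⁷ «SpineGivenEndpointR13SepCoPH»
(stmt-QuantumFields-20544), plan's skeleton **v5 941dddb108cbaacf** (stub 2 keyed on `GuardedReadingN16 𝔯 ksel ℓ ℓ₃ g B`; witness reading `PinnedAtLive jc sh cr`).  Filed `--kind proof
--supports` that item `--as helper` (proves no registered stub).  COUNT-NEUTRAL.  THEOREMS ONLY; 0 `def`; 0 `sorry`; `N`-generic, guard-generic `G`; NO Theses import.  Imports the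
sibling `…D4AtN16PinnedReading` (this seat g3) and dag-n20-d's V edition `…SpineReadingOfRecord13CoPHV` (p590105) — CITED BY NAME, none edited; it is the V-reading product of the
sibling exactly as g2's `…D4AtTuningWindowV` (p603299) is of `…D4AtTuningWindow` (dag-n19-d's K pattern: `Pf K := F.P (Koff + K)`, `d₀ := 4`, `L₀ := F.L`, `latticeLetters_family F Koff`;
`0 ≤ S.vol` by `T4Family.side_pos`).

WHAT THIS FILE PROVES (`S := crOfRecord₁₃VAt K₀ (jc F θ hP g₀ os) sh F θ hP g₀ os`, `R := rateCarriersOfRecord₁₃CoPH 𝔯 F θ hP g₀ os k`, `D := datumOfRecord₁₃CoPH F N θ hP`).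
* §1 ★★ `linkReadingAtN16PinnedReading_crOfRecord₁₃VAt_of_linkReadingAtN16PinnedReadingV` — this file's reading `hlinkN16V` (the sibling's `hlinkN16` at `S` minus the four lattice
  clauses and the volume sign) IS the sibling's `hlinkN16` at `cr := fun F θ hP g₀ os => S` (its text VERBATIM as the conclusion).
* §2 ★★ `h19HolderD4_crOfRecord₁₃VAt_of_linkReadingAtN16PinnedReading_tuned` — on tuned bare sequences with `b ≤ β ≤ b′` along the runs of record, `0 < b`, GIVEN `0 < R.u3.ρ` and node U2's
  smallness window: `PHolderD4 β D R` (spelled) `→ ∃ δ, NE7.Core S … δ ∧ Summable δ`, under v5's N16 key rows `N16PinnedLoose 𝔯 ℓ₃ B` ∕ the match row ∕ `N16LettersEnd N g ℓ₃` and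
  `hlinkN16V` — the sibling's §2 at `cr := fun … => S`.  (The prefix form, v5's `KeyedCoreEdgeHolderD4` text and the plug at `S`: sibling `…AtN16PinnedReadingVFSC`.)
N19's displayed residual AT THE V READING UNDER v5's KEY: NODE O's ledger world (i) ∕ (ii-m: `kappa₀ 64 8 ≤ R.u3.κ` + three `cells` clauses) ∕ (ii-v-A∕B) ∕ (ii-d) READ AT THE RUNS OF
RECORD, [III] Thm 2 (2.43) letters (N11), N14's positional count, the (v′-16) N16 ∕ N07 rows MINUS the seven of the sibling's §0 (regime `t`∕`ε` numerics, `4·((ℓ₃ F).ε ∕ B F) ≤ c'`,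
`LeafH3sup`, `sel`, `RegularSup`, liaison and reading rows), `ρ ≤ θc`, (T)'s `DecayBound` ∕ pair discs ∕ constants and the selector ON THE TUNING WINDOW.

HONEST FRAMING.  Count-neutral kernel bookkeeping; `hlinkN16V` is a HYPOTHESIS (NODE O's world; 0 instances in the tree); v5's three N16 key rows are HYPOTHESES asserted for no
reading; `D.Tuned` (K2⁷) and the β-window (K1⁷, `WorldP.b_pos`; lower half UNPRINTED T09.F) are HYPOTHESES; `K₀ jc sh 𝔯 G ℓ₃ g B` PARAMETERS (`sh` NOT inhabited).  NOT a proof of K3⁷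
or of any stub; no skeleton text touched.  NE7 for Bałaban's two runs is NOT PRINTED and NOT proved; nothing of Bałaban's is asserted or instantiated (K0⁷ OPEN); N16 ∕ N19 NOT
discharged; K3⁷ NOT claimed; Track A count unmoved (typed 28∕28 · discharged 5∕27 · A 5∕28).  One finite four-torus at fixed ε — R4 closes the CONDITIONAL finite-𝕋⁴ rung
`BalabanLadder.UV` only; NOT infinite volume, NOT OS on ℝ⁴, NOT a mass gap; the YM mass gap (Clay) is NOT proved by any of this.  Standard axioms.  Edits nothing.
-/

set_option autoImplicit false

noncomputable section

open Finset MeasureTheory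
open scoped BigOperators Matrix Matrix.Norms.L2Operator

namespace Summit.QuantumFields.YangMills.BalabanUVNodes.N19RateEdgeHolderD4AtN16PinnedReadingV

open Literature.MathematicalPhysics.QuantumFieldTheory.Balaban1983to89
open T4OutputRate T4RecentScale T4GoodClassBudget T4CauchySum T4TowerRateComposition T4TowerRateDischarge
open T4EtaRateMin (Readings NE3Shape)
open T4RateLiaison (GaugeDominated)
open FlowStep (RGEqH prefixOf)
open TreeLengthTorus (TFaceConnected torusTreeLen)
open B12TreeDecay (kappa₀)
open Summit.QuantumFields.BalabanUV.T4Continuum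
open AveragingDeficitDualResidual (dualC1 dualC2)
open AveragingDeficitDerivWallProof (wallConst)
open AveragingDeficitPeriodicCounting (IsPeriodicDir)
open MinimalActionSandwich (IsMinimiser minAct)
open MinimalActionRate (sfClass)
open MinimalActionRefine (RegularSup gradConst)
open NE3EnergyShapes (IsUnitarySite IsPeriodicSite)
open NE3.LeafIndexSockets (LeafH3sup)
open Summit.QuantumFields.BalabanUV.T4Continuum.Spine
open Summit.QuantumFields.BalabanUV.T4Continuum.Spine.NE4 (runFlow)
open Summit.QuantumFields.BalabanUV.T4Continuum.NE1p.DressedRoot (DressedTower DressedStabilityStrict)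
open Summit.QuantumFields.YangMills.BalabanUVNodes.N19LedgerLinkSync (LedgerDataSync LedgerAtSync)
open YMDAG.UVSplit (SpineCarriers SpineRecordPred InputsPred U3Carriers RateCarriers RateRecordPred N14At N18At N22At ReadOutAt)
open Summit.QuantumFields.YangMills.BalabanUVNodes.N16HolderDefs (CovRootHolder N16HolderAt)
open Summit.QuantumFields.YangMills.BalabanUVNodes.SpineRatesHolder (RatesHolderAt)
open Literature.MathematicalPhysics.QuantumFieldTheory.Balaban1983to89.T4Continuum (T4Family ULoop)
open YMDAG.UVSplit (Datum RateReading₁₃CoPH rateCarriersOfRecord₁₃CoPH ne3OfRecord₁₁)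
open Node00 (Stage13HParams datumOfRecord₁₃CoPH SiteSeqKey NE3Letters₁₁ ne3ConstLayerOfRecord₁₁ ne3NperOfRecord₁₁ ne3DomOfRecord₁₁)
open Summit.QuantumFields.YangMills.BalabanUVNodes.N16PinnedLayer13CoPH (N16PinnedLoose N16LettersEnd)
open YMDAG.UVSplit (ShellSplit₁₃CoPH crOfRecord₁₃VAt)
open Summit.QuantumFields.YangMills.BalabanUVNodes.N19RateEdgeRecordRunLetters (latticeLetters_family)
open Summit.QuantumFields.YangMills.BalabanUVNodes.N19RateEdgeHolderD4AtN16PinnedReading (h19HolderD4_datumOfRecord₁₃CoPH_of_linkReadingAtN16PinnedReading_tuned)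

variable {N : ℕ} [NeZero N]

section AtN16PinnedReadingV

variable (K₀ : ℕ)
  (jc : (F : T4Family) → (θ : Stage13HParams F N) → θ.Provisos₁₃CoPH F N → (ℕ → ℝ) → List (ULoop F) → ℕ → ℕ) (sh : ShellSplit₁₃CoPH N K₀)
  (𝔯 : RateReading₁₃CoPH N) (G : ∀ {F : T4Family}, Stage13HParams F N → Prop) {β : ℝ} (hβ1 : β ≤ 1)
  {ℓ₃ : T4Family → NE3Letters₁₁} {g B : T4Family → ℝ}
  (hlinkN16V : ∀ (F : T4Family) (θ : Stage13HParams F N) (hP : θ.Provisos₁₃CoPH F N), G θ → θ.Admissible F N →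
    ∀ (γ gIR b : ℝ) (g₀ : ℕ → ℝ), (datumOfRecord₁₃CoPH F N θ hP).Tuned γ gIR g₀ → γ ≤ θ.γ → γ ^ 2 ≤ Real.exp (-1) → 0 < b →
    (∀ K m, 0 ≤ m → m < K → b ≤ (datumOfRecord₁₃CoPH F N θ hP).βfun m (prefixOf (runFlow (datumOfRecord₁₃CoPH F N θ hP) g₀ K) m)) →
    ∀ (os : List (ULoop F)) (k : ℕ),
      let S : SpineCarriers := crOfRecord₁₃VAt K₀ (jc F θ hP g₀ os) sh F θ hP g₀ os
      let R : RateCarriers N := rateCarriersOfRecord₁₃CoPH 𝔯 F θ hP g₀ os k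
      let D : Datum F N := datumOfRecord₁₃CoPH F N θ hP
      letI := S.dec
      ∃ (_ : DecidableEq R.u3.C.Dom) (F' : Type) (ι' X' : Type) (_ : MeasurableSpace ι')
        (L : LedgerDataSync R.u3.C F' ι' S.ι) (Rd : Readings ι' X') (bsel : (ℕ → ℝ) → ℝ) (EB : Functional R.u3.C R.u3.C.BgB)
        (θc θ₃ : ℝ) (g : ℕ → ℕ → ℝ)
        (uA : ℕ → ι' → R.u3.C.BgA) (uB : ℕ → ι' → R.u3.C.BgB)
        (Koff : ℕ) (cells : (K j : ℕ) → R.u3.C.Dom → Finset (Site (F.P (Koff + K)) j))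
        (H033 : Flow → ℕ → Prop) (I : Type) (fam : I → B14.Sect2Data) (Lb βw : ℝ) (κ₁ : ℕ) (Gv Cl : ℝ) (K₁ : ℕ)
        (Λ₀ N₀ : ℝ) (dressed : R.u3.C.Dom → Prop) (_ : DecidablePred dressed)
        (c' t θ γ₃ l₁ : ℝ)
        (sel : ℕ → (B7Prop1Explicit.Site 4 → Fin 4 → (Matrix (Fin N) (Fin N) ℂ)ˣ) → (B7Prop1Explicit.Site 4 → Fin 4 → (Matrix (Fin N) (Fin N) ℂ)ˣ))
        (rd : ι' → (B7Prop1Explicit.Site 4 → Fin 4 → (Matrix (Fin N) (Fin N) ℂ)ˣ)) (k₀ : ℕ)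
        (E₀T κ₁T C₁T : ℝ) (q₁ : ℕ),
        (∀ K i, i ≤ K → g K i = runFlow D g₀ K i) ∧ (∀ K i, K < i → g K i = gIR) ∧
        EB = (fun s => R.u3.EB (bsel s) s) ∧
        (∀ (Sz : ℕ → ℝ → S.ι → ℕ → ℝ) (E₀ : ℝ) (m : ℕ) (a : ℝ) (Cw Λg : ℝ),
          (∀ K t, |t| ≤ S.l₀ → ∀ τ ∈ S.T K \ S.Bad K t, ∀ v ∈ Rd.dom, ∀ j ≤ K,
            |∑ X ∈ L.fac K t τ with R.u3.C.scale X = j,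
                (Real.log (Real.exp (EB (fun i => g (K + 1) (i + 1)) (uB K v) X
                    - EB (fun i => g (K + 1) (i + 1)) L.oneB X))
                  - Real.log (Real.exp (R.u3.EA (g K) (uA K v) X - R.u3.EA (g K) L.oneA X)))| ≤ Sz K t τ j) →
          0 ≤ E₀ → 0 < a → a < 1 →
          (∀ K t, |t| ≤ S.l₀ → ∀ τ ∈ S.T K \ S.Bad K t, ∀ j ≤ K,
            Sz K t τ j ≤ S.vol * (E₀ * ((K : ℝ) + 1) ^ m * a ^ (K - j))) →
          (∀ K, Multiplicity (L.All K) R.u3.C.scale (fun X => Real.exp (-(R.u3.κ * R.u3.C.d X))) Cw S.vol Λg K) →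
          (∀ K t, |t| ≤ S.l₀ → ∀ τ ∈ S.T K \ S.Bad K t,
            WindowMultiplicity (L.facO K t τ) L.scO L.wO Cw S.vol Λg (jlogOf L.Cl K) K) →
          1 ≤ Λg → L.θ' ≤ Λg →
          LedgerAtSync { L with S := Sz, E₀ := E₀, m := m, a := a, Cw := Cw, Λg := Λg } S.l₀ S.vol S.T S.Bad
            (fun K t τ => S.A K t τ - S.shA K t τ) (fun K t τ => S.B K t τ - S.shB K t τ) Rd R.u3.EA EB R.u3.κ g uA uB
            R.u3.ω θc R.u3.θ θ₃) ∧
        (∀ K t, |t| ≤ S.l₀ → ∀ τ ∈ S.T K \ S.Bad K t,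
          WindowMultiplicity (L.facO K t τ) L.scO L.wO L.Cw S.vol L.Λg (jlogOf L.Cl K) K) ∧
        0 ≤ L.Cw ∧ 1 ≤ L.Λg ∧ L.θ' ≤ L.Λg ∧
        kappa₀ (4 * 2 ^ 4) (2 * 4) ≤ R.u3.κ ∧
        (∀ K, ∀ X ∈ L.All K,
          (cells K (R.u3.C.scale X + Koff) X).Nonempty ∧ TFaceConnected (cells K (R.u3.C.scale X + Koff) X)) ∧
        (∀ K j, Set.InjOn (cells K j) ↑((L.All K).filter fun X => R.u3.C.scale X + Koff = j)) ∧
        (∀ K, ∀ X ∈ L.All K, torusTreeLen (cells K (R.u3.C.scale X + Koff) X) ≤ R.u3.C.d X) ∧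
        B14.Thm2Printed H033 fam Lb βw κ₁ ∧ βw < 1 ∧ 0 < βw ∧ 1 < Lb ∧ 1 ≤ Gv ∧ 0 ≤ Cl ∧
        (∀ p K, (R.ne1.𝒯.B p K).PositionalCount fun j k => N₀ * Λ₀ ^ (k - j)) ∧ 0 ≤ N₀ ∧ 0 ≤ Λ₀ ∧ Λ₀ ≤ R.ne1.Λ ∧
        (∀ K t, |t| ≤ S.l₀ → ∀ τ ∈ S.T K \ S.Bad K t, ∀ v ∈ Rd.dom, ∀ j ≤ K, ∃ (i : I) (w : (fam i).Ω) (j' : ℕ),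
          (fam i).flow.SatisfiesRG (fam i).K ∧ H033 (fam i).flow (fam i).K ∧ 1 ≤ j' ∧ j' ≤ (fam i).K ∧
          (fam i).K - j' = K - j ∧ (fam i).K ≤ K + K₁ ∧
          (∀ n, 0 ≤ (fam i).gammaVol n w) ∧ (fam i).gammaVol (fam i).K w ≤ S.vol ∧
          (∀ n, n < (fam i).K → n < jlogOf Cl (fam i).K → (fam i).gammaVol n w = 0) ∧
          (∀ n, n < (fam i).K → jlogOf Cl (fam i).K ≤ n → (fam i).gammaVol n w ≤ S.vol * Gv ^ ((fam i).K - n)) ∧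
          |∑ X ∈ (L.fac K t τ).filter (fun X => ¬ dressed X) with R.u3.C.scale X = j,
              (R.u3.EA (g K) (uA K v) X - R.u3.EA (g K) L.oneA X)| ≤ |(fam i).eTerm j' (fam i).K w|) ∧
        (∀ K t, |t| ≤ S.l₀ → ∀ τ ∈ S.T K \ S.Bad K t, ∀ v ∈ Rd.dom, ∀ j ≤ K, ∃ (i : I) (w : (fam i).Ω) (j' : ℕ),
          (fam i).flow.SatisfiesRG (fam i).K ∧ H033 (fam i).flow (fam i).K ∧ 1 ≤ j' ∧ j' ≤ (fam i).K ∧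
          (fam i).K - j' = K - j ∧ (fam i).K ≤ K + K₁ ∧
          (∀ n, 0 ≤ (fam i).gammaVol n w) ∧ (fam i).gammaVol (fam i).K w ≤ S.vol ∧
          (∀ n, n < (fam i).K → n < jlogOf Cl (fam i).K → (fam i).gammaVol n w = 0) ∧
          (∀ n, n < (fam i).K → jlogOf Cl (fam i).K ≤ n → (fam i).gammaVol n w ≤ S.vol * Gv ^ ((fam i).K - n)) ∧
          |∑ X ∈ (L.fac K t τ).filter (fun X => ¬ dressed X) with R.u3.C.scale X = j,
              (EB (fun i => g (K + 1) (i + 1)) (uB K v) X - EB (fun i => g (K + 1) (i + 1)) L.oneB X)|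
            ≤ |(fam i).eTerm j' (fam i).K w|) ∧
        (∀ K t, |t| ≤ S.l₀ → ∀ τ ∈ S.T K \ S.Bad K t, ∀ v ∈ Rd.dom,
          ∃ (pA : R.ne1.P) (βA : R.u3.C.Dom → (R.ne1.𝒯.B pA K).Birth) (Q : Finset (R.ne1.𝒯.B pA K).Cube) (pB : R.ne1.P)
            (KB : ℕ) (βB : R.u3.C.Dom → (R.ne1.𝒯.B pB KB).Birth),
          (∀ X ∈ (L.fac K t τ).filter (fun X => dressed X), (R.ne1.𝒯.B pA K).birthScale (βA X) = R.u3.C.scale X) ∧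
          (∀ j, Set.InjOn βA ↑(((L.fac K t τ).filter (fun X => dressed X)).filter fun X => R.u3.C.scale X = j)) ∧
          (∀ c ∈ Q, (R.ne1.𝒯.B pA K).cubeScale c = K) ∧ ((Q.card : ℝ) ≤ S.vol) ∧
          (∀ X ∈ (L.fac K t τ).filter (fun X => dressed X), ∃ c ∈ Q, βA X ∈ (R.ne1.𝒯.B pA K).feltAt c) ∧
          (∀ X ∈ (L.fac K t τ).filter (fun X => dressed X), KB - (R.ne1.𝒯.B pB KB).birthScale (βB X) = K - R.u3.C.scale X) ∧
          (∀ X ∈ (L.fac K t τ).filter (fun X => dressed X),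
            |R.u3.EA (g K) (uA K v) X - R.u3.EA (g K) L.oneA X| ≤ (R.ne1.𝒯.B pA K).size (βA X) K) ∧
          (∀ X ∈ (L.fac K t τ).filter (fun X => dressed X),
            |EB (fun i => g (K + 1) (i + 1)) (uB K v) X - EB (fun i => g (K + 1) (i + 1)) L.oneB X|
              ≤ (R.ne1.𝒯.B pB KB).size (βB X) KB)) ∧
        R.ne3.g = gradConst 4 c' ∧ 0 ≤ c' ∧ R.ne3.b ≤ t ∧ c' ≤ t ∧
        (2 : ℝ) ^ 91 * (R.ne3.L : ℝ) ^ 17 * t ≤ 1 ∧ (2 : ℝ) ^ 76 * (R.ne3.L : ℝ) ^ 12 * t ≤ R.ne3.ε ∧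
        16 * B7Prop2Explicit.C0 4 * R.ne3.ε ≤ 3 ∧ 1024 * (4 + 1) * (4 + 4) * (R.ne3.L : ℝ) ^ 2 * R.ne3.ε ≤ 1 ∧
        4 * ((ℓ₃ F).ε / B F) ≤ c' ∧
        LeafH3sup 4 R.ne3.L R.ne3.Nper R.ne3.ε R.ne3.b c' R.ne3.dom ∧
        (∀ V ∈ R.ne3.dom, ∀ k : ℕ, IsMinimiser 4 (sfClass 4 R.ne3.L R.ne3.Nper R.ne3.ε) R.ne3.L R.ne3.Nper k V (sel k V)) ∧
        (∀ V ∈ R.ne3.dom, ∀ k : ℕ, RegularSup 4 R.ne3.L R.ne3.Nper R.ne3.b c' k (sel k V)) ∧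
        0 < θ ∧ θ ^ 6 = ((R.ne3.L : ℝ))⁻¹ ∧ 0 < γ₃ ∧
        R.ne3.C * (wallConst 4 R.ne3.L * (R.ne3.Nper : ℝ) ^ 2 *
          (Real.sqrt (gradConst 4 c') * dualC2 4 R.ne3.L + 2 * R.ne3.b ^ 2 * dualC1 4 R.ne3.L)) ≤ γ₃ ^ 3 ∧
        0 < l₁ ∧ R.ne3.Λ₁ ≤ l₁ ^ 3 ∧ γ₃ * θ ^ 2 ≤ l₁ * R.ne3.Nper ∧ θ ^ ((3 : ℝ) * β - 2) ≤ θ₃ ∧ θ₃ < 1 ∧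
        (∀ v ∈ Rd.dom, rd v ∈ R.ne3.dom) ∧
        (∀ k, ∀ v ∈ Rd.dom, Rd.act k v = minAct 4 (sfClass 4 R.ne3.L R.ne3.Nper R.ne3.ε) R.ne3.L R.ne3.Nper k (rd v)) ∧
        (R.ne3.Nper : ℝ) ^ 4 ≤ Rd.vol ∧ 1 ≤ k₀ ∧
        (∀ K : ℕ, ∀ v ∈ Rd.dom, ∀ (u : B7Prop1Explicit.Site 4 → (Matrix (Fin N) (Fin N) ℂ)ˣ)
          (Z : B7Prop1Explicit.Site 4 → Fin 4 → Matrix (Fin N) (Fin N) ℂ) (M : ℝ),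
          IsUnitarySite u → IsPeriodicSite u ((R.ne3.Nper * R.ne3.L ^ (k₀ + K) : ℕ) : ℤ) → T4AveragingDeficitWall.IsSkewDir Z →
          IsPeriodicDir Z ((R.ne3.Nper * R.ne3.L ^ (k₀ + K) : ℕ) : ℤ) →
          B7Prop1Explicit.gaugeAct u (sel (k₀ + K) (rd v)) =
            T4AveragingDeficitWall.vary (B7Prop2Explicit.rescale R.ne3.L (B7Prop1Explicit.bavg R.ne3.L (sel (k₀ + K + 1) (rd v)))) Z 1 →
          (∀ (x : B7Prop1Explicit.Site 4) (κ : Fin 4), (R.ne3.L : ℝ) ^ (k₀ + K) * ‖Z x κ‖ ≤ M) →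
          (∀ (x : B7Prop1Explicit.Site 4) (μ κ : Fin 4), ((R.ne3.L : ℝ) ^ (k₀ + K)) ^ 2 *
              ‖T4AveragingDeficitWall.Ad (B7Prop2Explicit.rescale R.ne3.L (B7Prop1Explicit.bavg R.ne3.L (sel (k₀ + K + 1) (rd v)))
                  (x + B7Prop1Explicit.e κ) μ) (Z (x + B7Prop1Explicit.e μ) κ) - Z x κ‖ ≤ M) →
          R.u3.C.gauge (uA K v) (R.u3.C.transport (uB K v)) ≤ M) ∧
        R.u3.ρ ≤ θc ∧
        DecayBound R.u3.EA (Window γ) E₀T R.u3.κ ∧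
        (∀ s ∈ Window γ, ∀ (X : R.u3.C.Dom) (U U' : R.u3.C.BgA),
          R.u3.C.gauge U U' < κ₁T * B14.alphaJ C₁T q₁ (s (R.u3.C.scale X)) →
          ∃ f : ℂ → ℂ, DifferentiableOn ℂ f (Metric.ball (0 : ℂ) (κ₁T * B14.alphaJ C₁T q₁ (s (R.u3.C.scale X)))) ∧
            f 0 = (R.u3.EA s U X : ℂ) ∧ f (R.u3.C.gauge U U' : ℂ) = (R.u3.EA s U' X : ℂ) ∧
            ∀ z ∈ Metric.ball (0 : ℂ) (κ₁T * B14.alphaJ C₁T q₁ (s (R.u3.C.scale X))),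
              ‖f z‖ ≤ E₀T * Real.exp (-(R.u3.κ * R.u3.C.d X))) ∧
        0 ≤ E₀T ∧ 0 < κ₁T ∧ 0 < C₁T ∧
        (∀ s ∈ Window γ, 0 < bsel s ∧ bsel s ≤ γ))

include hlinkN16V

/-- ★★ **THE N16-PINNED LINK READING AT THE V READING IS THE SIBLING's N16-PINNED LINK READING AT `cr := crOfRecord₁₃VAt K₀ (jc …) sh`** [bookkeeping]: this file's
displayed hypothesis `hlinkN16V` (the sibling's `hlinkN16` at `S := crOfRecord₁₃VAt K₀ (jc F θ hP g₀ os) sh F θ hP g₀ os` with (ii-m)'s reference ledger ON THE FAMILY's OWN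
LATTICES — `Pf K := F.P (Koff + K)`, `d₀ := 4`, `L₀ := F.L` — the four lattice clauses and the volume sign REMOVED) yields the sibling's `hlinkN16` text at that reading VERBATIM:
the lattice clauses are `latticeLetters_family F Koff` (dag-n19-d's K pattern, this seat g0) at `S.vol = F.side ^ 4` (`rfl`), `0 ≤ S.vol` is `T4Family.side_pos`; everything
else passes through.  `hlinkN16V` is a HYPOTHESIS (0 instances); nothing of N16 ∕ N19 proved. -/
theorem linkReadingAtN16PinnedReading_crOfRecord₁₃VAt_of_linkReadingAtN16PinnedReadingV :
    ∀ (F : T4Family) (θ : Stage13HParams F N) (hP : θ.Provisos₁₃CoPH F N), G θ → θ.Admissible F N →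
    ∀ (γ gIR b : ℝ) (g₀ : ℕ → ℝ), (datumOfRecord₁₃CoPH F N θ hP).Tuned γ gIR g₀ → γ ≤ θ.γ → γ ^ 2 ≤ Real.exp (-1) → 0 < b →
    (∀ K m, 0 ≤ m → m < K → b ≤ (datumOfRecord₁₃CoPH F N θ hP).βfun m (prefixOf (runFlow (datumOfRecord₁₃CoPH F N θ hP) g₀ K) m)) →
    ∀ (os : List (ULoop F)) (k : ℕ),
      let S : SpineCarriers := crOfRecord₁₃VAt K₀ (jc F θ hP g₀ os) sh F θ hP g₀ os
      let R : RateCarriers N := rateCarriersOfRecord₁₃CoPH 𝔯 F θ hP g₀ os k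
      let D : Datum F N := datumOfRecord₁₃CoPH F N θ hP
      letI := S.dec
      ∃ (_ : DecidableEq R.u3.C.Dom) (F' : Type) (ι' X' : Type) (_ : MeasurableSpace ι')
        (L : LedgerDataSync R.u3.C F' ι' S.ι) (Rd : Readings ι' X') (bsel : (ℕ → ℝ) → ℝ) (EB : Functional R.u3.C R.u3.C.BgB)
        (θc θ₃ : ℝ) (g : ℕ → ℕ → ℝ)
        (uA : ℕ → ι' → R.u3.C.BgA) (uB : ℕ → ι' → R.u3.C.BgB)
        (Pf : ℕ → Params) (d₀ L₀ Koff : ℕ) (cells : (K j : ℕ) → R.u3.C.Dom → Finset (Site (Pf K) j))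
        (H033 : Flow → ℕ → Prop) (I : Type) (fam : I → B14.Sect2Data) (Lb βw : ℝ) (κ₁ : ℕ) (Gv Cl : ℝ) (K₁ : ℕ)
        (Λ₀ N₀ : ℝ) (dressed : R.u3.C.Dom → Prop) (_ : DecidablePred dressed)
        (c' t θ γ₃ l₁ : ℝ)
        (sel : ℕ → (B7Prop1Explicit.Site 4 → Fin 4 → (Matrix (Fin N) (Fin N) ℂ)ˣ) → (B7Prop1Explicit.Site 4 → Fin 4 → (Matrix (Fin N) (Fin N) ℂ)ˣ))
        (rd : ι' → (B7Prop1Explicit.Site 4 → Fin 4 → (Matrix (Fin N) (Fin N) ℂ)ˣ)) (k₀ : ℕ)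
        (E₀T κ₁T C₁T : ℝ) (q₁ : ℕ),
        (∀ K i, i ≤ K → g K i = runFlow D g₀ K i) ∧ (∀ K i, K < i → g K i = gIR) ∧
        EB = (fun s => R.u3.EB (bsel s) s) ∧
        (∀ (Sz : ℕ → ℝ → S.ι → ℕ → ℝ) (E₀ : ℝ) (m : ℕ) (a : ℝ) (Cw Λg : ℝ),
          (∀ K t, |t| ≤ S.l₀ → ∀ τ ∈ S.T K \ S.Bad K t, ∀ v ∈ Rd.dom, ∀ j ≤ K,
            |∑ X ∈ L.fac K t τ with R.u3.C.scale X = j,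
                (Real.log (Real.exp (EB (fun i => g (K + 1) (i + 1)) (uB K v) X
                    - EB (fun i => g (K + 1) (i + 1)) L.oneB X))
                  - Real.log (Real.exp (R.u3.EA (g K) (uA K v) X - R.u3.EA (g K) L.oneA X)))| ≤ Sz K t τ j) →
          0 ≤ E₀ → 0 < a → a < 1 →
          (∀ K t, |t| ≤ S.l₀ → ∀ τ ∈ S.T K \ S.Bad K t, ∀ j ≤ K,
            Sz K t τ j ≤ S.vol * (E₀ * ((K : ℝ) + 1) ^ m * a ^ (K - j))) →
          (∀ K, Multiplicity (L.All K) R.u3.C.scale (fun X => Real.exp (-(R.u3.κ * R.u3.C.d X))) Cw S.vol Λg K) →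
          (∀ K t, |t| ≤ S.l₀ → ∀ τ ∈ S.T K \ S.Bad K t,
            WindowMultiplicity (L.facO K t τ) L.scO L.wO Cw S.vol Λg (jlogOf L.Cl K) K) →
          1 ≤ Λg → L.θ' ≤ Λg →
          LedgerAtSync { L with S := Sz, E₀ := E₀, m := m, a := a, Cw := Cw, Λg := Λg } S.l₀ S.vol S.T S.Bad
            (fun K t τ => S.A K t τ - S.shA K t τ) (fun K t τ => S.B K t τ - S.shB K t τ) Rd R.u3.EA EB R.u3.κ g uA uB
            R.u3.ω θc R.u3.θ θ₃) ∧
        0 ≤ S.vol ∧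
        (∀ K t, |t| ≤ S.l₀ → ∀ τ ∈ S.T K \ S.Bad K t,
          WindowMultiplicity (L.facO K t τ) L.scO L.wO L.Cw S.vol L.Λg (jlogOf L.Cl K) K) ∧
        0 ≤ L.Cw ∧ 1 ≤ L.Λg ∧ L.θ' ≤ L.Λg ∧
        (∀ K, (Pf K).d = d₀) ∧ (∀ K, (Pf K).L = L₀) ∧ (∀ K, (Pf K).K = Koff + K) ∧
        (∀ K, (Fintype.card (Site (Pf K) (Pf K).K) : ℝ) = S.vol) ∧
        kappa₀ (4 * 2 ^ d₀) (2 * d₀) ≤ R.u3.κ ∧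
        (∀ K, ∀ X ∈ L.All K,
          (cells K (R.u3.C.scale X + Koff) X).Nonempty ∧ TFaceConnected (cells K (R.u3.C.scale X + Koff) X)) ∧
        (∀ K j, Set.InjOn (cells K j) ↑((L.All K).filter fun X => R.u3.C.scale X + Koff = j)) ∧
        (∀ K, ∀ X ∈ L.All K, torusTreeLen (cells K (R.u3.C.scale X + Koff) X) ≤ R.u3.C.d X) ∧
        B14.Thm2Printed H033 fam Lb βw κ₁ ∧ βw < 1 ∧ 0 < βw ∧ 1 < Lb ∧ 1 ≤ Gv ∧ 0 ≤ Cl ∧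
        (∀ p K, (R.ne1.𝒯.B p K).PositionalCount fun j k => N₀ * Λ₀ ^ (k - j)) ∧ 0 ≤ N₀ ∧ 0 ≤ Λ₀ ∧ Λ₀ ≤ R.ne1.Λ ∧
        (∀ K t, |t| ≤ S.l₀ → ∀ τ ∈ S.T K \ S.Bad K t, ∀ v ∈ Rd.dom, ∀ j ≤ K, ∃ (i : I) (w : (fam i).Ω) (j' : ℕ),
          (fam i).flow.SatisfiesRG (fam i).K ∧ H033 (fam i).flow (fam i).K ∧ 1 ≤ j' ∧ j' ≤ (fam i).K ∧
          (fam i).K - j' = K - j ∧ (fam i).K ≤ K + K₁ ∧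
          (∀ n, 0 ≤ (fam i).gammaVol n w) ∧ (fam i).gammaVol (fam i).K w ≤ S.vol ∧
          (∀ n, n < (fam i).K → n < jlogOf Cl (fam i).K → (fam i).gammaVol n w = 0) ∧
          (∀ n, n < (fam i).K → jlogOf Cl (fam i).K ≤ n → (fam i).gammaVol n w ≤ S.vol * Gv ^ ((fam i).K - n)) ∧
          |∑ X ∈ (L.fac K t τ).filter (fun X => ¬ dressed X) with R.u3.C.scale X = j,
              (R.u3.EA (g K) (uA K v) X - R.u3.EA (g K) L.oneA X)| ≤ |(fam i).eTerm j' (fam i).K w|) ∧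
        (∀ K t, |t| ≤ S.l₀ → ∀ τ ∈ S.T K \ S.Bad K t, ∀ v ∈ Rd.dom, ∀ j ≤ K, ∃ (i : I) (w : (fam i).Ω) (j' : ℕ),
          (fam i).flow.SatisfiesRG (fam i).K ∧ H033 (fam i).flow (fam i).K ∧ 1 ≤ j' ∧ j' ≤ (fam i).K ∧
          (fam i).K - j' = K - j ∧ (fam i).K ≤ K + K₁ ∧
          (∀ n, 0 ≤ (fam i).gammaVol n w) ∧ (fam i).gammaVol (fam i).K w ≤ S.vol ∧
          (∀ n, n < (fam i).K → n < jlogOf Cl (fam i).K → (fam i).gammaVol n w = 0) ∧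
          (∀ n, n < (fam i).K → jlogOf Cl (fam i).K ≤ n → (fam i).gammaVol n w ≤ S.vol * Gv ^ ((fam i).K - n)) ∧
          |∑ X ∈ (L.fac K t τ).filter (fun X => ¬ dressed X) with R.u3.C.scale X = j,
              (EB (fun i => g (K + 1) (i + 1)) (uB K v) X - EB (fun i => g (K + 1) (i + 1)) L.oneB X)|
            ≤ |(fam i).eTerm j' (fam i).K w|) ∧
        (∀ K t, |t| ≤ S.l₀ → ∀ τ ∈ S.T K \ S.Bad K t, ∀ v ∈ Rd.dom,
          ∃ (pA : R.ne1.P) (βA : R.u3.C.Dom → (R.ne1.𝒯.B pA K).Birth) (Q : Finset (R.ne1.𝒯.B pA K).Cube) (pB : R.ne1.P)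
            (KB : ℕ) (βB : R.u3.C.Dom → (R.ne1.𝒯.B pB KB).Birth),
          (∀ X ∈ (L.fac K t τ).filter (fun X => dressed X), (R.ne1.𝒯.B pA K).birthScale (βA X) = R.u3.C.scale X) ∧
          (∀ j, Set.InjOn βA ↑(((L.fac K t τ).filter (fun X => dressed X)).filter fun X => R.u3.C.scale X = j)) ∧
          (∀ c ∈ Q, (R.ne1.𝒯.B pA K).cubeScale c = K) ∧ ((Q.card : ℝ) ≤ S.vol) ∧
          (∀ X ∈ (L.fac K t τ).filter (fun X => dressed X), ∃ c ∈ Q, βA X ∈ (R.ne1.𝒯.B pA K).feltAt c) ∧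
          (∀ X ∈ (L.fac K t τ).filter (fun X => dressed X), KB - (R.ne1.𝒯.B pB KB).birthScale (βB X) = K - R.u3.C.scale X) ∧
          (∀ X ∈ (L.fac K t τ).filter (fun X => dressed X),
            |R.u3.EA (g K) (uA K v) X - R.u3.EA (g K) L.oneA X| ≤ (R.ne1.𝒯.B pA K).size (βA X) K) ∧
          (∀ X ∈ (L.fac K t τ).filter (fun X => dressed X),
            |EB (fun i => g (K + 1) (i + 1)) (uB K v) X - EB (fun i => g (K + 1) (i + 1)) L.oneB X|
              ≤ (R.ne1.𝒯.B pB KB).size (βB X) KB)) ∧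
        R.ne3.g = gradConst 4 c' ∧ 0 ≤ c' ∧ R.ne3.b ≤ t ∧ c' ≤ t ∧
        (2 : ℝ) ^ 91 * (R.ne3.L : ℝ) ^ 17 * t ≤ 1 ∧ (2 : ℝ) ^ 76 * (R.ne3.L : ℝ) ^ 12 * t ≤ R.ne3.ε ∧
        16 * B7Prop2Explicit.C0 4 * R.ne3.ε ≤ 3 ∧ 1024 * (4 + 1) * (4 + 4) * (R.ne3.L : ℝ) ^ 2 * R.ne3.ε ≤ 1 ∧
        4 * ((ℓ₃ F).ε / B F) ≤ c' ∧
        LeafH3sup 4 R.ne3.L R.ne3.Nper R.ne3.ε R.ne3.b c' R.ne3.dom ∧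
        (∀ V ∈ R.ne3.dom, ∀ k : ℕ, IsMinimiser 4 (sfClass 4 R.ne3.L R.ne3.Nper R.ne3.ε) R.ne3.L R.ne3.Nper k V (sel k V)) ∧
        (∀ V ∈ R.ne3.dom, ∀ k : ℕ, RegularSup 4 R.ne3.L R.ne3.Nper R.ne3.b c' k (sel k V)) ∧
        0 < θ ∧ θ ^ 6 = ((R.ne3.L : ℝ))⁻¹ ∧ 0 < γ₃ ∧
        R.ne3.C * (wallConst 4 R.ne3.L * (R.ne3.Nper : ℝ) ^ 2 *
          (Real.sqrt (gradConst 4 c') * dualC2 4 R.ne3.L + 2 * R.ne3.b ^ 2 * dualC1 4 R.ne3.L)) ≤ γ₃ ^ 3 ∧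
        0 < l₁ ∧ R.ne3.Λ₁ ≤ l₁ ^ 3 ∧ γ₃ * θ ^ 2 ≤ l₁ * R.ne3.Nper ∧ θ ^ ((3 : ℝ) * β - 2) ≤ θ₃ ∧ θ₃ < 1 ∧
        (∀ v ∈ Rd.dom, rd v ∈ R.ne3.dom) ∧
        (∀ k, ∀ v ∈ Rd.dom, Rd.act k v = minAct 4 (sfClass 4 R.ne3.L R.ne3.Nper R.ne3.ε) R.ne3.L R.ne3.Nper k (rd v)) ∧
        (R.ne3.Nper : ℝ) ^ 4 ≤ Rd.vol ∧ 1 ≤ k₀ ∧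
        (∀ K : ℕ, ∀ v ∈ Rd.dom, ∀ (u : B7Prop1Explicit.Site 4 → (Matrix (Fin N) (Fin N) ℂ)ˣ)
          (Z : B7Prop1Explicit.Site 4 → Fin 4 → Matrix (Fin N) (Fin N) ℂ) (M : ℝ),
          IsUnitarySite u → IsPeriodicSite u ((R.ne3.Nper * R.ne3.L ^ (k₀ + K) : ℕ) : ℤ) → T4AveragingDeficitWall.IsSkewDir Z →
          IsPeriodicDir Z ((R.ne3.Nper * R.ne3.L ^ (k₀ + K) : ℕ) : ℤ) →
          B7Prop1Explicit.gaugeAct u (sel (k₀ + K) (rd v)) =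
            T4AveragingDeficitWall.vary (B7Prop2Explicit.rescale R.ne3.L (B7Prop1Explicit.bavg R.ne3.L (sel (k₀ + K + 1) (rd v)))) Z 1 →
          (∀ (x : B7Prop1Explicit.Site 4) (κ : Fin 4), (R.ne3.L : ℝ) ^ (k₀ + K) * ‖Z x κ‖ ≤ M) →
          (∀ (x : B7Prop1Explicit.Site 4) (μ κ : Fin 4), ((R.ne3.L : ℝ) ^ (k₀ + K)) ^ 2 *
              ‖T4AveragingDeficitWall.Ad (B7Prop2Explicit.rescale R.ne3.L (B7Prop1Explicit.bavg R.ne3.L (sel (k₀ + K + 1) (rd v)))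
                  (x + B7Prop1Explicit.e κ) μ) (Z (x + B7Prop1Explicit.e μ) κ) - Z x κ‖ ≤ M) →
          R.u3.C.gauge (uA K v) (R.u3.C.transport (uB K v)) ≤ M) ∧
        R.u3.ρ ≤ θc ∧
        DecayBound R.u3.EA (Window γ) E₀T R.u3.κ ∧
        (∀ s ∈ Window γ, ∀ (X : R.u3.C.Dom) (U U' : R.u3.C.BgA),
          R.u3.C.gauge U U' < κ₁T * B14.alphaJ C₁T q₁ (s (R.u3.C.scale X)) →
          ∃ f : ℂ → ℂ, DifferentiableOn ℂ f (Metric.ball (0 : ℂ) (κ₁T * B14.alphaJ C₁T q₁ (s (R.u3.C.scale X)))) ∧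
            f 0 = (R.u3.EA s U X : ℂ) ∧ f (R.u3.C.gauge U U' : ℂ) = (R.u3.EA s U' X : ℂ) ∧
            ∀ z ∈ Metric.ball (0 : ℂ) (κ₁T * B14.alphaJ C₁T q₁ (s (R.u3.C.scale X))),
              ‖f z‖ ≤ E₀T * Real.exp (-(R.u3.κ * R.u3.C.d X))) ∧
        0 ≤ E₀T ∧ 0 < κ₁T ∧ 0 < C₁T ∧
        (∀ s ∈ Window γ, 0 < bsel s ∧ bsel s ≤ γ) := by
  intro F θ hP hG hθ γ gIR b g₀ ht hγle hγe hb0 hlow os k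
  obtain ⟨iDom, F', ι', X', iMeas, L, Rd, bsel, EB, θc, θ₃, gr, uA, uB, hrest⟩ := hlinkN16V F θ hP hG hθ γ gIR b g₀ ht hγle hγe hb0 hlow os k
  obtain ⟨Koff, cells, H033, I, fam, Lb, βw, κ₁, Gv, Cl, K₁, Λ₀, N₀, dressed, iDr, hrest⟩ := hrest
  obtain ⟨c', t, ϑ, γ₃, l₁, sel, rd, k₀, E₀T, κ₁T, C₁T, q₁, hrest⟩ := hrest
  obtain ⟨hgle, hggt, hEB, hL, homult, hCw, hΛg, hθΛ, hκ₀, hdom, hinj, hlen, hrest⟩ := hrest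
  obtain ⟨hPd, hPL, hPK, hcard⟩ := latticeLetters_family F Koff
  have hvol : (0 : ℝ) ≤ (crOfRecord₁₃VAt K₀ (jc F θ hP g₀ os) sh F θ hP g₀ os).vol := pow_nonneg F.side_pos.le 4
  exact ⟨iDom, F', ι', X', iMeas, L, Rd, bsel, EB, θc, θ₃, gr, uA, uB, fun K => F.P (Koff + K), 4, F.L, Koff, cells, H033, I, fam, Lb, βw, κ₁, Gv, Cl, K₁,
    Λ₀, N₀, dressed, iDr, c', t, ϑ, γ₃, l₁, sel, rd, k₀, E₀T, κ₁T, C₁T, q₁, hgle, hggt, hEB, hL, hvol, homult, hCw, hΛg, hθΛ, hPd, hPL, hPK,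
    hcard, hκ₀, hdom, hinj, hlen, hrest⟩

/-! ## §2 N19′'s edge on tuned bare sequences at the V reading with node N16's layer pinned loose -/

include hβ1 in
/-- ★★ **N19′'s EDGE AT THE V READING `crOfRecord₁₃VAt K₀ (jc …) sh`, N16 LAYER PINNED LOOSE, ON TUNED BARE SEQUENCES** [bookkeeping]: at every guarded admissible Stage-13 tuple,
every bare sequence `g₀` TUNED to `gIR` within `]0, γ]` (`γ ≤ θ.γ`, `γ² ≤ e⁻¹`; a HYPOTHESIS), `b ≤ β ≤ b′` ALONG ITS RUNS OF RECORD with `0 < b` (K1⁷'s window; a HYPOTHESIS),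
every `os k`, GIVEN `0 < R.u3.ρ` and node U2's smallness window: `PHolderD4 β D R → ∃ δ, NE7.Core S … δ ∧ Summable δ` for `S := crOfRecord₁₃VAt K₀ (jc F θ hP g₀ os) sh F θ hP g₀ os`
— the sibling's `h19HolderD4_…AtN16PinnedReading_tuned` at `cr := fun F θ hP g₀ os => S` and §1's reading, under v5's three N16 key rows `hpin` ∕ `hmatch` ∕ `hend` (HYPOTHESES).
NOT NE7; N16 ∕ N19 NOT discharged; NOT `stub_expansion13H`. -/
theorem h19HolderD4_crOfRecord₁₃VAt_of_linkReadingAtN16PinnedReading_tuned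
    (hpin : N16PinnedLoose 𝔯 ℓ₃ B) (hmatch : ∀ F : T4Family, 0 < B F ∧ (ℓ₃ F).ε / B F ≤ (ℓ₃ F).b) (hend : N16LettersEnd N g ℓ₃)
    (F : T4Family) (θ : Stage13HParams F N) (hP : θ.Provisos₁₃CoPH F N) (hG : G θ) (hθ : θ.Admissible F N) {γ gIR b' : ℝ} {g₀ : ℕ → ℝ}
    (ht : (datumOfRecord₁₃CoPH F N θ hP).Tuned γ gIR g₀) (hγle : γ ≤ θ.γ) (hγe : γ ^ 2 ≤ Real.exp (-1)) {b : ℝ} (hb0 : 0 < b)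
    (hlow : ∀ K m, 0 ≤ m → m < K →
      b ≤ (datumOfRecord₁₃CoPH F N θ hP).βfun m (prefixOf (runFlow (datumOfRecord₁₃CoPH F N θ hP) g₀ K) m))
    (halong : ∀ K i, i < K →
      (datumOfRecord₁₃CoPH F N θ hP).βfun i (prefixOf (runFlow (datumOfRecord₁₃CoPH F N θ hP) g₀ K) i) ≤ b')
    (os : List (ULoop F)) (k : ℕ) (hρ0 : 0 < (rateCarriersOfRecord₁₃CoPH 𝔯 F θ hP g₀ os k).u3.ρ)
    (hsmall : (rateCarriersOfRecord₁₃CoPH 𝔯 F θ hP g₀ os k).u3.cr * (rateCarriersOfRecord₁₃CoPH 𝔯 F θ hP g₀ os k).u3.C₉ *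
        (rateCarriersOfRecord₁₃CoPH 𝔯 F θ hP g₀ os k).u3.ω * (γ ^ 3 + 2 * γ / b) ≤ (1 - (rateCarriersOfRecord₁₃CoPH 𝔯 F θ hP g₀ os k).u3.ρ) / 2)
    (hP4 : RatesHolderAt (datumOfRecord₁₃CoPH F N θ hP) (rateCarriersOfRecord₁₃CoPH 𝔯 F θ hP g₀ os k) β ∧
      ReadOutAt (datumOfRecord₁₃CoPH F N θ hP) (rateCarriersOfRecord₁₃CoPH 𝔯 F θ hP g₀ os k).u3 ∧
      (0 ≤ (rateCarriersOfRecord₁₃CoPH 𝔯 F θ hP g₀ os k).u3.ρ ∧ (rateCarriersOfRecord₁₃CoPH 𝔯 F θ hP g₀ os k).u3.ρ < 1)) :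
    letI := (crOfRecord₁₃VAt K₀ (jc F θ hP g₀ os) sh F θ hP g₀ os).dec
    ∃ δ : ℕ → ℝ, NE7.Core (crOfRecord₁₃VAt K₀ (jc F θ hP g₀ os) sh F θ hP g₀ os).l₀ (crOfRecord₁₃VAt K₀ (jc F θ hP g₀ os) sh F θ hP g₀ os).vol (crOfRecord₁₃VAt K₀ (jc F θ hP g₀ os) sh F θ hP g₀ os).T
      (crOfRecord₁₃VAt K₀ (jc F θ hP g₀ os) sh F θ hP g₀ os).Bad
      (fun K t τ => (crOfRecord₁₃VAt K₀ (jc F θ hP g₀ os) sh F θ hP g₀ os).A K t τ - (crOfRecord₁₃VAt K₀ (jc F θ hP g₀ os) sh F θ hP g₀ os).shA K t τ)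
      (fun K t τ => (crOfRecord₁₃VAt K₀ (jc F θ hP g₀ os) sh F θ hP g₀ os).B K t τ - (crOfRecord₁₃VAt K₀ (jc F θ hP g₀ os) sh F θ hP g₀ os).shB K t τ) δ ∧
      Summable δ :=
  h19HolderD4_datumOfRecord₁₃CoPH_of_linkReadingAtN16PinnedReading_tuned (fun F θ hP g₀ os => crOfRecord₁₃VAt K₀ (jc F θ hP g₀ os) sh F θ hP g₀ os) 𝔯 G hβ1
    (linkReadingAtN16PinnedReading_crOfRecord₁₃VAt_of_linkReadingAtN16PinnedReadingV K₀ jc sh 𝔯 G hlinkN16V) hpin hmatch hend F θ hP hG hθ ht hγle hγe hb0 hlow halong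
    os k hρ0 hsmall hP4

end AtN16PinnedReadingV
end Summit.QuantumFields.YangMills.BalabanUVNodes.N19RateEdgeHolderD4AtN16PinnedReadingV
end
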